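import Literature.MathematicalPhysics.QuantumFieldTheory.Balaban1983to89.B3GaussianPerturbationGraphs
import Literature.MathematicalPhysics.QuantumFieldTheory.Balaban1983to89.B3Eq119VertexExpansion
import Literature.MathematicalPhysics.QuantumFieldTheory.Balaban1983to89.B1Eq221Coordinates
import Literature.MathematicalPhysics.QuantumFieldTheory.Balaban1983to89.HiggsCovariancePos
import Literature.MathematicalPhysics.QuantumFieldTheory.Balaban1983to89.HiggsFluctMeasurePos

/-!
# `Balaban1983to89.B3Eq119ConnectedGraphs` — T. Bałaban, *(Higgs)₂,₃ quantum fields in a finite volume. III.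
# Renormalization*, Commun. Math. Phys. **88** (1983) 411–445 [Balaban1983Higgs3], (1.19)–(1.21) p. 416: «The function
# G^ε has a perturbative expansion … graphs of the expansion of G^ε … The propagators are C^ε_0 for the scalar field» —
# AT CHARGE `e = 0`, THE VERTEX COEFFICIENTS OF THE TWO-POINT FUNCTION (1.19) ARE THE SUMS OVER THE CONNECTED FEYNMAN
# GRAPHS with vertices (1.6), (1.7), two external legs and lines `C^ε_0 = (−Δ^ε_0 + m²)^{−1}` (the instance of the
# engine `B3GaussianPerturbationGraphs` on the `(Higgs)₂,₃` carrier of record; BRICK 5 of `B3TwoPointPerturbativeExpansion`)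

statement-level skeleton of published theorems with citation tags; proofs where landed; nothing here is a claim about
the Yang–Mills mass gap

CITATION HEADER (lean-in-tree rule).  Part of the lit-balaban TYPED SKELETON (HOME `run/shared/lean/pub/lit-balaban/`),
Phase 2, proof seat p33 (gen 71, unit `lit-balaban-p33`); row **B3.Eq1.19-1.22** of `HOME/lit-balaban-r15/ROWS-B3.md` (fold
owner r15; head `proved` under the lead's HEAD WORD Q25 — this file is an OPTIONAL located member of the (1.19)/(1.21) cell, zero
head weight: BRICK 5 «the Wick step at general order ↦ graph sums» (r15 g15 2026-08-23T08:29:23Z / WELCOME 09:54:21Z), on top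
of BRICK 4 = this seat's gen-70 pair `B3TwoPointPerturbativeCoefficients` (the `t`-derivatives of a Gibbs expectation are pinned
truncated expectations) / `B3Eq119VertexExpansion` (the (1.19) instance: `twoPointFamily`, `freeMeasure`, `vertices`,
`iteratedDerivWithin_twoPointFamily_eq_ursellOf`)).  REUSED BY NAME, nothing re-declared: the typer's carrier `HiggsLattice`
(`action` (I.1.11), `covDeriv` (I.1.7), `covLaplaceForm`, `siteInner`/`bondInner` (I.1.5), `ChargeData.U`), `HiggsCovariance.covLaplacianN`
(the covariant Laplacian of (I.2.17)) with `HiggsCovariancePos.siteInner_covLaplacianN_univ(_self)/_comm/_nonneg`,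
`HiggsFluctMeasurePos.siteInner_*` (algebra of (I.1.5)); p34's integration coordinates `B1Eq221Coordinates.{fieldCoord, formMatrix,
formMatrix_form, formMatrix_transpose, integral_comp_fieldCoord, sum_inner_eq_dotProduct}`; p13's Gaussian `B2Eq228Conditioning.weight`,
`BIJ88TruncationConnected306.gexp`; the combinatorics of record `Literature.Probability.LatticeModels.{ursellOf, LegDiagram.diags/IsConn}`;
the sibling engine `B3GaussianPerturbationGraphs` (`clusterVar`, `jmoment`, `pairW`, `legVec`, `Leg`, `gexp_two_legs`,
`ursellOf_jmoment_univ`).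

THE PRINT (p. 416 = PDF 6 of the held text `paper:balaban1983-higgs-2-3-quantum-fields-finite-volume`; read in gen 70, p. 414 re-read
this session): «G^ε_{ab}(x, x′) = ⟨φ_a(x)φ_b(x′)⟩^ε = (Z^ε)^{−1}∫dA∫dφ e^{−S^ε(A,φ)}φ_a(x)φ_b(x′) (1.19) … S^ε(A,φ) =
½⟨φ,(−Δ^ε_A + m²)φ⟩ + Σ_{x∈T_ε}ε^d(λ|φ(x)|⁴ + ½δm²|φ(x)|²) + ½⟨A,(−Δ^ε + μ₀²)A⟩ (1.20) … The function G^ε has a perturbative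
expansion of the following structure G^ε = Σ_n C^ε_0[(−δm² + Σ^ε + …)C^ε_0]ⁿ (1.21) where C^ε_0 = (−Δ^ε_0 + m²)^{−1} and Σ^ε, Σ^ε_1,
Σ^ε_2 are given by amputated, one-particle-irreducible graphs of the expansion of G^ε. Here we have a graphical description of
the same type as in (1.17) … the only vertices are (1.6), (1.7) [with δm² …], (1.8), and (1.10) … The propagators are C^ε_0 for
the scalar field and C^ε = (−Δ^ε + μ₀²)^{−1} for the vector field (of course internal indices and vector indices are understood
here).»  WHAT THIS FILE MAKES A THEOREM: at `e = 0` (no vertices (1.8)/(1.10): the vector field decouples) «the expansion of G^ε»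
into graphs — the `n`-th vertex coefficient of (1.19) IS the sum over the connected Feynman graphs with `n` vertices of type
(1.6)/(1.7), two external scalar legs, and lines `C^ε_0`, where `C^ε_0` IS `(−Δ^ε_0 + m²)^{−1}` for the scalar product (I.1.5).

WHAT IS PROVED (0 `sorry`, no `Prop` fact; standard axioms; `C : ChargeData N` with `C.e = 0`, every level `k`, every `N`).
* §1 `chargeU_eq_one` (`U ≡ 1`), `covDeriv_eq_of_charge_zero` (`D^ε_A = D^ε_0`), **`action_free_eq_of_charge_zero`**:
  `S^ε_{(m²,0,μ₀²,0)}(A,φ) = vecAction(A) + scalAction(φ)` with `scalAction φ = ½Σ_bε^d|D₀φ(b)|² + ½m²⟨φ,φ⟩`.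
* §2 `freeOp C m² = −Δ^{ε,N}_{0,T} + m²` (the typer's covariant Laplacian at `A = 0` plus the mass; `= HiggsCovariance.delta0 … 0 m²`
  at level 0, `freeOp_eq_delta0`), its form `siteInner_freeOp(_comm/_self/_self_ge)`, the bilinear map `freeForm`, the
  PRECISION MATRIX `precMat = formMatrix freeForm` in p34's coordinates `fc = fieldCoord` on `Crd = sites × Idx(ℝ^N)`,
  `dotProduct_precMat_mulVec` (it represents the form), `precMat_transpose`, **`precMat_posDef`** (`m² > 0`), `weight_precMat`
  (`e^{−½(fc φ)ᵀprecMat(fc φ)} = e^{−scalAction φ}`).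
* §3 `expect0 G = ∫G(φ)dν₀/∫dν₀`; **`integral_freeMeasure_snd`** (`∫G(φ)dν₀ = Z_A·∫e^{−scalAction}G`, Fubini on the decoupled
  product), `integral_freeMeasure_snd_coord` (p34's change of variables), `integral_one_freeMeasure_pos`, `zVec_ne_zero`, and
  **`expect0_eq_gexp`**: `⟨G⟩₀ = gexp precMat 0 (G ∘ fc⁻¹)` — at `e = 0` the scalar marginal of `ν₀` IS p13's finite-dimensional
  centred Gaussian with precision `precMat`.
* §4 the legs `legV x a` with **`dotProduct_legV`** (`(fc φ)·legV x a = φ_a(x)`), `fc_symm_apply`, `siteInner_delta`; the free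
  propagator **`prop0 x a x′ b = ⟨φ_a(x)φ_b(x′)⟩₀`** with `prop0_symm`, **`prop0_eq_inv`** (`= ⟨precMat⁻¹ legV x a, legV x′ b⟩`, Wick
  with two legs), the column `propCol` (`propCol_apply`), `freeOp_injective` and **`freeOp_propCol`: `(−Δ^ε_0 + m²)C₀(·;x′,b) =
  ε^{−d}δ_{x′}⊗e_b`** — «C^ε_0 = (−Δ^ε_0 + m²)^{−1}» as the (unique) Green's function for the `ε^d`-weighted scalar product.
* §5 the vertices and the observable as polynomial clusters of the engine: colours `Colour = Unit ⊕ (T×[N]×[N]) ⊕ (T×[N])`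
  (observable / quartic (1.6) / mass (1.7)), `cdeg`, `legPos`, `clv`, `ccoef` (`1`, `−λε^d`, `−½δm²ε^d`), `cK`;
  `clusterVar_none` (`= φ_a(x)φ_b(x′)`), **`clusterVar_some`** (`= −V(φ) = −Σ_yε^d(λ|φ(y)|⁴ + ½δm²|φ(y)|²)` = minus the gen-70
  `vertices`), `prod_clusterVar_fc`, **`jmoment_eq_expect0`** and **`pinnedMoments_eq_expect0`** (the engine's cluster moments
  and BRICK 4's pinned moments at `t = 0` are the same unperturbed expectations `⟨F^{[none∈Q]}(−V)^{#(Q∖{none})}⟩₀`),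
  **`pairW_legs`** (the weight of a pair of legs is `C₀` between their positions/indices), `twoPointFamily_zero` (order 0 = `C₀`).
* §7 «internal indices understood» (`e = 0`): `freeOp_apply_apply` (the operator acts componentwise), `freeOp_compProj`,
  `freeOp_compSwap`, **`prop0_eq_zero_of_ne`** (`C₀(x,a;x′,b) = 0` for `a ≠ b`), **`prop0_diag_eq`** (the diagonal does not depend
  on the index), `prop0_eq_ite` (`C₀(x,a;x′,b) = δ_{ab}C₀(x,a;x′,a)`) — by uniqueness of the Green's function.
* §8 (v1.1, append-only) THE COEFFICIENTS AS POLYNOMIALS IN `(λ, δm²)`: `isQuartic`, `qCount`, `prod_ccoef_eq`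
  (`Π_j ccoef = (−λε^d)^{q(z)}(−½δm²ε^d)^{n−q(z)}`), `graphSum n q` (the connected-graph sum over the colourings with `q` quartic
  vertices — independent of `(λ, δm²)`), `sum_colourings_eq_polynomial`, **`iteratedDerivWithin_twoPointFamily_eq_polynomial`**:
  `(d/dt)ⁿG^ε_t|_{0⁺} = Σ_{q≤n} λ^q(δm²)^{n−q}·(−ε^d)^q(−½ε^d)^{n−q}·graphSum n q` — print's series in the coupling constants at
  `e = 0` ((1.21)–(1.23); `δm²` is itself a series in `λ`), each coefficient a sum of connected graphs with `q` vertices (1.6)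
  and `n − q` vertices (1.7).
* §9 (v1.2, append-only) TRANSLATION INVARIANCE «`C^ε_0(x − x′)`»: `freeOp_translate` (`−Δ^ε_0 + m²` commutes with the unit
  translations of the torus), `translate_propCol`, **`prop0_shift`**: `C₀(x + εe_μ, a; x′ + εe_μ, b) = C₀(x, a; x′, b)`.
* §6 THE HEADLINE **`iteratedDerivWithin_twoPointFamily_eq_sum_connected`**: for `e = 0`, `m² > 0`, `μ₀² > 0`, `λ > 0`, all `n`,
  `(d/dt)ⁿ G^ε_t,ab(x,x′)|_{t=0⁺} = Σ_{z ∈ Π_j cK j} (Π_j ccoef j z_j) · Σ_{τ CONNECTED pairing of the legs of z} Π_{{l,l′}∈τ} pairW`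
  (BRICK 4's `iteratedDerivWithin_twoPointFamily_eq_ursellOf` + the engine's `ursellOf_jmoment_univ`): with
  `twoPoint_perturbative_expansion` (gen 70) the two-point function (1.19) equals, to every order with remainder, the sum of its
  connected Feynman graphs with ≤ n vertices (1.6)/(1.7) — the vacuum graphs cancelled against `Z^ε`.
HONEST SCOPE.  (i) `e = 0` ONLY: the vector field decouples (`action_free_eq_of_charge_zero`) and the vertices (1.8)/(1.10) of
print's double series in `(e, λ)` do not occur; at `e ≠ 0` the scalar marginal of `ν₀` is not Gaussian and this file says nothing;
(ii) the expansion parameter is the vertex number at fixed `(λ, δm²)` (BRICK 4); each colouring carries its monomial in `(λ, δm²)`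
(`ccoef`); the regrouping into the `(λ, δm²)`-polynomial is §8 (v1.1), the re-expansion of `δm²(λ)` by (1.23) is not performed; (iii) graphs are LABELLED pairings
of legs (the engine's `LegDiagram` diagrams with `IsConn`); no symmetry factors, no 1PI decomposition (1.21) (p32/p37's bricks), no
amputation; (iv) `C₀` is identified by its Green's-function equation for the operator `−Δ^{ε,N}_{0,T} + m²` of the typer's
`HiggsCovariance` (print's `−Δ^ε_0`, the covariant Laplacian at `A = 0`); its `δ_{ab}` structure (§7) and its invariance under
the unit translations (§9, v1.2; `C^ε_0(x − x′)`) are PROVED (p37's `B3Eq122TorusPropagators` has the scalar torus kernel on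
`Setup`'s tori with its decay bounds — not bridged here); (v) hypotheses `m² > 0`, `μ₀² > 0`
(finite Gaussians), `λ > 0` (BRICK 4's integrability), level `k = 0` in §6 as in (1.19); nothing about `ε → 0`.
(v1.3, doc-only: the cite locus of `iteratedDerivWithin_twoPointFamily_eq_polynomial` corrected to «(1.21)–(1.23) pp.416–417» —
(1.23), the `δm²` display, is printed on p. 417 — per summit-lit1 g91 P91-002; declarations byte-identical to v1.2.)
(v1.4, doc-only: the five cite tags «(1.6)-(1.7) p.414» / «(1.6) p.414» of §5 and §8 corrected to p. 413 — the displays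
(1.6), (1.7) are printed on p. 413 (PDF 3 of the held text, L4–7); p. 414 opens with (1.15) — per summit-lit1 g98 P98-001;
declarations byte-identical to v1.3.)
-/

noncomputable section

open MeasureTheory Matrix Finset
open scoped BigOperators InnerProductSpace

namespace Literature.MathematicalPhysics.QuantumFieldTheory.Balaban1983to89.B3Eq119ConnectedGraphs

open HiggsLattice HiggsCovariance B1Eq221Coordinates B3Eq119VertexExpansion B3TwoPointPerturbativeCoefficients
  B3GaussianPerturbationGraphs
open HiggsCovariancePos (siteInner_covLaplacianN_univ_self siteInner_covLaplacianN_univ siteInner_covLaplacianN_comm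
  siteInner_self_eq siteInner_self_nonneg eq_zero_of_siteInner_self_eq_zero)
open HiggsFluctMeasurePos (siteInner_comm siteInner_add_right siteInner_smul_right siteInner_smul_left)
open Literature.MathematicalPhysics.QuantumFieldTheory.BalabanImbrieJaffe1984to88.BIJ88TruncationConnected306 (gexp)
open Literature.Probability.LatticeModels (ursellOf)
open Literature.Probability.LatticeModels.LegDiagram (diags IsConn legs)
open Literature.MathematicalPhysics.QuantumFieldTheory.Balaban1983to89.B2Eq228Conditioning (weight)

variable {P : HiggsLattice.Params} {k N : ℕ}

/-! ## §1 The charge-zero model: `U ≡ 1`, the covariant derivative is the lattice derivative, the action splits -/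

/-- At `e = 0` the representation is trivial: `U(A) = exp(qε·0·A) = 1`. [cite: Balaban1982Higgs1, (1.7) p.605] -/
theorem chargeU_eq_one (C : ChargeData N) (he : C.e = 0) (η t : ℝ) : C.U η t = 1 := by
  rw [ChargeData.U, he, mul_zero, zero_mul, zero_smul ℝ C.q, NormedSpace.exp_zero]

/-- At `e = 0` the covariant derivative (1.7) is the one at `A = 0` (the lattice derivative (1.4)) for EVERY vector
field `A`. [cite: Balaban1982Higgs1, (1.7) p.605] -/
theorem covDeriv_eq_of_charge_zero (C : ChargeData N) (he : C.e = 0) (A : HiggsLattice.VecField P k) (φ : ScalarField P k N)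
    (b : HiggsLattice.PBond P k) : covDeriv C A φ b = covDeriv C 0 φ b := by
  rw [covDeriv, covDeriv, chargeU_eq_one C he, chargeU_eq_one C he]

/-- Hence the covariant kinetic form does not see `A` at `e = 0`. [cite: Balaban1982Higgs1, (1.11) p.605] -/
theorem covLaplaceForm_eq_of_charge_zero (C : ChargeData N) (he : C.e = 0) (A : HiggsLattice.VecField P k)
    (φ : ScalarField P k N) : covLaplaceForm C A φ = covLaplaceForm C 0 φ := by
  unfold covLaplaceForm
  exact Finset.sum_congr rfl fun b _ => by rw [covDeriv_eq_of_charge_zero C he]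

/-- The vector-field part of the massive free action (1.20)/(I.1.11): `½⟨A,(−Δ^ε + μ₀²)A⟩`.
[cite: Balaban1983Higgs3, (1.20) p.416] -/
def vecAction (P : HiggsLattice.Params) (k : ℕ) (mu0sq : ℝ) (A : HiggsLattice.VecField P k) : ℝ :=
  (vecLaplaceForm A + ∑ b : HiggsLattice.PBond P k, P.mesh k ^ P.d * (mu0sq * A b ^ 2)) / 2

/-- The scalar-field part of the massive free action at `e = 0`: `½⟨φ,(−Δ^ε_0 + m²)φ⟩ = ½Σ_bε^d|∂φ(b)|² + ½m²Σ_xε^d|φ(x)|²`.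
[cite: Balaban1983Higgs3, (1.20) p.416] -/
def scalAction (C : ChargeData N) (msq : ℝ) (φ : ScalarField P k N) : ℝ :=
  covLaplaceForm C 0 φ / 2 + msq / 2 * siteInner φ φ

/-- The massless-coupling potential of `⟨m², 0, μ₀², 0⟩` is `½m²⟨φ,φ⟩`. [cite: Balaban1982Higgs1, (1.11) p.605] -/
theorem potential_free (msq mu0sq : ℝ) (φ : ScalarField P k N) :
    potential (P := P) (k := k) ⟨msq, 0, mu0sq, 0⟩ φ = msq / 2 * siteInner φ φ := by
  rw [siteInner_self_eq, potential, Finset.mul_sum]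
  exact Finset.sum_congr rfl fun x _ => by ring

/-- **At `e = 0` the free action (1.20) splits**: `S^ε_{(m²,0,μ₀²,0)}(A,φ) = ½⟨A,(−Δ^ε+μ₀²)A⟩ + ½⟨φ,(−Δ^ε_0+m²)φ⟩` — the
vector field decouples from the scalar field. [cite: Balaban1983Higgs3, (1.20) p.416] -/
theorem action_free_eq_of_charge_zero (C : ChargeData N) (he : C.e = 0) (msq mu0sq : ℝ) (A : HiggsLattice.VecField P k)
    (φ : ScalarField P k N) :
    action C ⟨msq, 0, mu0sq, 0⟩ A φ = vecAction P k mu0sq A + scalAction C msq φ := by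
  rw [action, covLaplaceForm_eq_of_charge_zero C he, potential_free, vecAction, scalAction]
  ring

/-! ## §2 The free scalar operator `−Δ^ε_0 + m²`, its form, and the precision matrix in integration coordinates -/

/-- **`−Δ^ε_0 + m²`**: the covariant Laplacian of (I.2.17) at `A = 0` on the whole torus plus the mass — the operator
whose inverse is print's `C^ε_0 = (−Δ^ε_0 + m²)^{−1}` ((1.21); [I] (2.17): `Δ^{(0),ε}(T_ε, 0)`).
[cite: Balaban1983Higgs3, (1.21) p.416] -/
def freeOp (C : ChargeData N) (msq : ℝ) : ScalarField P k N →ₗ[ℝ] ScalarField P k N :=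
  covLaplacianN C Finset.univ 0 + msq • LinearMap.id

/-- On the `ε`-lattice (level `0`) `−Δ^ε_0 + m²` IS the typer's `Δ^{(0),ε}(T_ε, 0)` of [I] (2.17) (definitional).
[cite: Balaban1982Higgs1, (2.17) p.610] -/
theorem freeOp_eq_delta0 (C : ChargeData N) (msq : ℝ) :
    freeOp (P := P) (k := 0) C msq = delta0 C Finset.univ 0 msq := rfl

/-- `(−Δ^ε_0 + m²)φ = −Δ^{ε,N}_{0,T}φ + m²φ`. [cite: Balaban1983Higgs3, (1.21) p.416] -/
theorem freeOp_apply (C : ChargeData N) (msq : ℝ) (φ : ScalarField P k N) :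
    freeOp C msq φ = covLaplacianN C Finset.univ 0 φ + msq • φ := rfl

/-- `⟨ψ,(−Δ^ε_0+m²)φ⟩ = Σ_bε^d D₀ψ(b)·D₀φ(b) + m²⟨ψ,φ⟩`. [cite: Balaban1983Higgs3, (1.20) p.416] -/
theorem siteInner_freeOp (C : ChargeData N) (msq : ℝ) (ψ φ : ScalarField P k N) :
    siteInner ψ (freeOp C msq φ) = bondInner (covDeriv C 0 ψ) (covDeriv C 0 φ) + msq * siteInner ψ φ := by
  rw [freeOp_apply, siteInner_add_right, siteInner_covLaplacianN_univ, siteInner_smul_right]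

/-- The form is symmetric. [cite: Balaban1983Higgs3, (1.20) p.416] -/
theorem siteInner_freeOp_comm (C : ChargeData N) (msq : ℝ) (ψ φ : ScalarField P k N) :
    siteInner ψ (freeOp C msq φ) = siteInner φ (freeOp C msq ψ) := by
  rw [siteInner_freeOp, siteInner_freeOp, siteInner_comm ψ φ]
  congr 1
  unfold bondInner
  exact Finset.sum_congr rfl fun b _ => by rw [real_inner_comm]

/-- The diagonal of the form is twice the scalar free action: `⟨φ,(−Δ^ε_0+m²)φ⟩ = 2·S_φ(φ)`. [cite: Balaban1983Higgs3, (1.20) p.416] -/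
theorem siteInner_freeOp_self (C : ChargeData N) (msq : ℝ) (φ : ScalarField P k N) :
    siteInner φ (freeOp C msq φ) = 2 * scalAction C msq φ := by
  rw [freeOp_apply, siteInner_add_right, siteInner_covLaplacianN_univ_self, siteInner_smul_right, scalAction]
  ring

/-- The form dominates `m²⟨φ,φ⟩`. [cite: Balaban1983Higgs3, (1.20) p.416] -/
theorem siteInner_freeOp_self_ge (C : ChargeData N) (msq : ℝ) (φ : ScalarField P k N) :
    msq * siteInner φ φ ≤ siteInner φ (freeOp C msq φ) := by
  rw [freeOp_apply, siteInner_add_right, siteInner_smul_right]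
  have h := HiggsCovariancePos.siteInner_covLaplacianN_nonneg C Finset.univ (0 : HiggsLattice.VecField P k) φ
  linarith

/-- The free form `(ψ, φ) ↦ ⟨ψ,(−Δ^ε_0+m²)φ⟩` as a bilinear map. [cite: Balaban1983Higgs3, (1.20) p.416] -/
def freeForm (C : ChargeData N) (msq : ℝ) : ScalarField P k N →ₗ[ℝ] ScalarField P k N →ₗ[ℝ] ℝ :=
  LinearMap.mk₂ ℝ (fun ψ φ => siteInner ψ (freeOp C msq φ))
    (fun ψ ψ' φ => by
      show siteInner (ψ + ψ') _ = siteInner ψ _ + siteInner ψ' _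
      rw [siteInner_comm, siteInner_add_right, siteInner_comm, siteInner_comm (freeOp C msq φ)])
    (fun c ψ φ => by
      show siteInner (c • ψ) _ = c • siteInner ψ _
      rw [siteInner_smul_left, smul_eq_mul])
    (fun ψ φ φ' => by
      show siteInner ψ (freeOp C msq (φ + φ')) = siteInner ψ _ + siteInner ψ _
      rw [map_add, siteInner_add_right])
    (fun c ψ φ => by
      show siteInner ψ (freeOp C msq (c • φ)) = c • siteInner ψ _
      rw [map_smul, siteInner_smul_right, smul_eq_mul])

/-- [cite: Balaban1983Higgs3, (1.20) p.416] -/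
@[simp] theorem freeForm_apply (C : ChargeData N) (msq : ℝ) (ψ φ : ScalarField P k N) :
    freeForm C msq ψ φ = siteInner ψ (freeOp C msq φ) := rfl

/-- The integration coordinates of the scalar configurations: `(sites) × (orthonormal index of ℝ^N)` (p34's
`B1Eq221Coordinates`). [cite: Balaban1982Higgs1, p.605] -/
abbrev Crd (P : HiggsLattice.Params) (k N : ℕ) : Type := HiggsLattice.Site P k × Idx (E N)

/-- The coordinate map `φ ↦ ((x,i) ↦ ⟪b_i, φ(x)⟫)` of p34 on the scalar fields of `T^{(k)}`. [cite: Balaban1982Higgs1, p.605] -/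
abbrev fc (P : HiggsLattice.Params) (k N : ℕ) : ScalarField P k N ≃ₗ[ℝ] (Crd P k N → ℝ) :=
  fieldCoord (E N) (HiggsLattice.Site P k)

/-- **The precision matrix** of the free scalar Gaussian in integration coordinates: the matrix of `⟨·,(−Δ^ε_0+m²)·⟩`.
[cite: Balaban1983Higgs3, (1.20) p.416] -/
def precMat (C : ChargeData N) (msq : ℝ) : Matrix (Crd P k N) (Crd P k N) ℝ :=
  formMatrix (freeForm (P := P) (k := k) C msq)

/-- The precision matrix represents the free form: `(fc ψ)ᵀ·precMat·(fc φ) = ⟨ψ,(−Δ^ε_0+m²)φ⟩`.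
[cite: Balaban1983Higgs3, (1.20) p.416] -/
theorem dotProduct_precMat_mulVec (C : ChargeData N) (msq : ℝ) (ψ φ : ScalarField P k N) :
    fc P k N ψ ⬝ᵥ (precMat C msq *ᵥ fc P k N φ) = siteInner ψ (freeOp C msq φ) :=
  formMatrix_form (freeForm C msq) ψ φ

/-- The precision matrix is symmetric. [cite: Balaban1983Higgs3, (1.20) p.416] -/
theorem precMat_transpose (C : ChargeData N) (msq : ℝ) : (precMat (P := P) (k := k) C msq)ᵀ = precMat C msq :=
  formMatrix_transpose fun ψ φ => siteInner_freeOp_comm C msq ψ φ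

/-- **The precision matrix is positive definite** for `m² > 0`. [cite: Balaban1983Higgs3, (1.20) p.416] -/
theorem precMat_posDef (C : ChargeData N) {msq : ℝ} (hm : 0 < msq) : (precMat (P := P) (k := k) C msq).PosDef := by
  refine Matrix.posDef_iff_dotProduct_mulVec.mpr ⟨?_, fun z hz => ?_⟩
  · rw [Matrix.IsHermitian, Matrix.conjTranspose_eq_transpose_of_trivial, precMat_transpose]
  · have hφ : (fc P k N).symm z ≠ 0 := by
      intro h0
      apply hz
      rw [← (fc P k N).apply_symm_apply z, h0, map_zero]
    have hpos : 0 < siteInner ((fc P k N).symm z) ((fc P k N).symm z) :=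
      lt_of_le_of_ne (siteInner_self_nonneg _) fun h => hφ (eq_zero_of_siteInner_self_eq_zero _ h.symm)
    have h := siteInner_freeOp_self_ge C msq ((fc P k N).symm z)
    have h2 := dotProduct_precMat_mulVec C msq ((fc P k N).symm z) ((fc P k N).symm z)
    rw [LinearEquiv.apply_symm_apply] at h2
    simp only [star_trivial]
    rw [h2]
    nlinarith [mul_pos hm hpos]

/-- The Gaussian weight of the precision matrix at `fc φ` is `exp(−S_φ(φ))`. [cite: Balaban1983Higgs3, (1.20) p.416] -/
theorem weight_precMat (C : ChargeData N) (msq : ℝ) (φ : ScalarField P k N) :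
    weight (precMat C msq) (fc P k N φ) = Real.exp (-scalAction C msq φ) := by
  rw [B2Eq228Conditioning.weight, dotProduct_precMat_mulVec, siteInner_freeOp_self]
  congr 1
  ring

/-! ## §3 The unperturbed measure at `e = 0` is the product of the two free Gaussians; expectations of scalar
observables are Gaussian expectations in integration coordinates -/

/-- The normalized expectation of a scalar-field observable in the unperturbed measure `ν₀`:
`⟨G⟩₀ = ∫ G(φ) dν₀ / ∫ dν₀`. [cite: Balaban1983Higgs3, (1.19) p.416] -/
def expect0 (P : HiggsLattice.Params) (k N : ℕ) (C : ChargeData N) (msq mu0sq : ℝ)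
    (G : ScalarField P k N → ℝ) : ℝ :=
  (∫ Φ, G Φ.2 ∂(freeMeasure P k N C msq mu0sq)) / ∫ _Φ, (1 : ℝ) ∂(freeMeasure P k N C msq mu0sq)

/-- The vector-field Gaussian integral `Z_A = ∫ exp(−½⟨A,(−Δ^ε+μ₀²)A⟩) dA`. [cite: Balaban1982Higgs1, (1.12) p.606] -/
def zVec (P : HiggsLattice.Params) (k : ℕ) (mu0sq : ℝ) : ℝ := ∫ A : HiggsLattice.VecField P k, Real.exp (-vecAction P k mu0sq A)

/-- **Product structure at `e = 0`**: for every scalar observable `G`,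
`∫ G(φ) dν₀ = Z_A · ∫ exp(−S_φ(φ)) G(φ) dφ`. [cite: Balaban1982Higgs1, (1.12) p.606] -/
theorem integral_freeMeasure_snd (C : ChargeData N) (he : C.e = 0) (msq mu0sq : ℝ) (G : ScalarField P k N → ℝ) :
    ∫ Φ, G Φ.2 ∂(freeMeasure P k N C msq mu0sq)
      = zVec P k mu0sq * ∫ φ : ScalarField P k N, Real.exp (-scalAction C msq φ) * G φ := by
  rw [integral_freeMeasure]
  have h : (fun Φ : Cfg P k N => Real.exp (-action C ⟨msq, 0, mu0sq, 0⟩ Φ.1 Φ.2) * G Φ.2)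
      = fun Φ => Real.exp (-vecAction P k mu0sq Φ.1) * (Real.exp (-scalAction C msq Φ.2) * G Φ.2) := by
    funext Φ
    rw [action_free_eq_of_charge_zero C he, neg_add, Real.exp_add, mul_assoc]
  rw [h, Measure.volume_eq_prod, integral_prod_mul (μ := (volume : Measure (HiggsLattice.VecField P k)))
    (ν := (volume : Measure (ScalarField P k N))) (fun A => Real.exp (-vecAction P k mu0sq A))
    (fun φ => Real.exp (-scalAction C msq φ) * G φ), zVec]

/-- … and in integration coordinates: `∫ G(φ) dν₀ = Z_A · ∫ G(fc⁻¹z)·e^{−½zᵀ·precMat·z} dz`.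
[cite: Balaban1982Higgs1, p.605] -/
theorem integral_freeMeasure_snd_coord (C : ChargeData N) (he : C.e = 0) (msq mu0sq : ℝ)
    (G : ScalarField P k N → ℝ) :
    ∫ Φ, G Φ.2 ∂(freeMeasure P k N C msq mu0sq)
      = zVec P k mu0sq * ∫ z : Crd P k N → ℝ, G ((fc P k N).symm z) * weight (precMat C msq) z := by
  rw [integral_freeMeasure_snd C he, integral_comp_fieldCoord (E N) (HiggsLattice.Site P k)]
  congr 1
  refine integral_congr_ae (ae_of_all _ fun z => ?_)
  dsimp only
  rw [← weight_precMat, LinearEquiv.apply_symm_apply, mul_comm]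

/-- The total mass of `ν₀` is positive (`m² > 0`, `μ₀² > 0`). [cite: Balaban1982Higgs1, (1.10) p.605] -/
theorem integral_one_freeMeasure_pos (C : ChargeData N) {msq mu0sq : ℝ} (hm : 0 < msq) (hmu : 0 < mu0sq) :
    0 < ∫ _Φ, (1 : ℝ) ∂(freeMeasure P k N C msq mu0sq) := by
  rw [integral_freeMeasure]
  simp only [mul_one]
  haveI : (volume : Measure (Cfg P k N)).IsAddHaarMeasure :=
    Measure.prod.instIsAddHaarMeasure (volume : Measure (HiggsLattice.VecField P k))
      (volume : Measure (ScalarField P k N))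
  have hint : Integrable fun Φ : Cfg P k N => Real.exp (-action C ⟨msq, 0, mu0sq, 0⟩ Φ.1 Φ.2) := by
    have h := integrable_mul_exp_of_le_pow_quartic (P := P) (k := k) hm hmu C 0 (h := fun _ => (1 : ℝ))
      continuous_const (K := 1) (n := 0) (fun Φ => by simp)
    simpa only [one_mul] using h
  exact integral_exp_pos hint

/-- `Z_A ≠ 0` at `e = 0` (from the positivity of the total mass and the product structure).
[cite: Balaban1982Higgs1, (1.12) p.606] -/
theorem zVec_ne_zero (C : ChargeData N) (he : C.e = 0) {msq mu0sq : ℝ} (hm : 0 < msq) (hmu : 0 < mu0sq) :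
    zVec P k mu0sq ≠ 0 := by
  have h := integral_one_freeMeasure_pos (P := P) (k := k) C hm hmu
  rw [integral_freeMeasure_snd C he msq mu0sq (fun _ => (1 : ℝ))] at h
  exact left_ne_zero_of_mul h.ne'

/-- **SCALAR EXPECTATIONS OF `ν₀` AT `e = 0` ARE GAUSSIAN EXPECTATIONS**: for every scalar observable `G`,
`⟨G⟩₀ = ⟨G ∘ fc⁻¹⟩_{e^{−½zᵀ·precMat·z}dz}` — the vector-field Gaussian cancels in the ratio.
[cite: Balaban1983Higgs3, (1.19)–(1.21) p.416] -/
theorem expect0_eq_gexp (C : ChargeData N) (he : C.e = 0) {msq mu0sq : ℝ} (hm : 0 < msq) (hmu : 0 < mu0sq)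
    (G : ScalarField P k N → ℝ) :
    expect0 P k N C msq mu0sq G = gexp (precMat (P := P) (k := k) C msq) 0 fun z => G ((fc P k N).symm z) := by
  have hden : (∫ _Φ, (1 : ℝ) ∂(freeMeasure P k N C msq mu0sq))
      = zVec P k mu0sq * ∫ z : Crd P k N → ℝ, (1 : ℝ) * weight (precMat C msq) z :=
    integral_freeMeasure_snd_coord C he msq mu0sq (fun _ => 1)
  rw [expect0, integral_freeMeasure_snd_coord C he, hden, mul_div_mul_left _ _ (zVec_ne_zero C he hm hmu),
    gexp_zero_source]
  simp only [one_mul]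

/-! ## §4 The legs `φ_a(x)` as linear functionals of the coordinates; the free propagator and its Green's-function
equation `(−Δ^ε_0 + m²)C^ε_0 = ε^{−d}δ` -/

/-- The leg vector of the field component `φ_a(x)` in integration coordinates. [cite: Balaban1983Higgs3, (1.19) p.416] -/
def legV (x : HiggsLattice.Site P k) (a : Fin N) : Crd P k N → ℝ :=
  fc P k N (Pi.single x (EuclideanSpace.single a (1 : ℝ)))

/-- `Σ_y ⟪χ(y), (δ_x ⊗ e_a)(y)⟫ = χ_a(x)`. [cite: Balaban1982Higgs1, (1.5) p.604] -/
theorem sum_inner_single (χ : ScalarField P k N) (x : HiggsLattice.Site P k) (a : Fin N) :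
    ∑ y, ⟪χ y, (Pi.single x (EuclideanSpace.single a (1 : ℝ)) : ScalarField P k N) y⟫_ℝ = χ x a := by
  rw [Finset.sum_eq_single x (fun y _ hy => by rw [Pi.single_eq_of_ne hy, inner_zero_right])
    (fun h => absurd (Finset.mem_univ x) h), Pi.single_eq_same, EuclideanSpace.inner_single_right]
  simp

/-- **The legs are linear functionals of the coordinates**: `(fc φ)·legV x a = φ_a(x)`. [cite: Balaban1983Higgs3, (1.19) p.416] -/
theorem dotProduct_legV (φ : ScalarField P k N) (x : HiggsLattice.Site P k) (a : Fin N) :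
    fc P k N φ ⬝ᵥ legV x a = φ x a := by
  rw [legV, ← sum_inner_eq_dotProduct (E N), sum_inner_single]

/-- … read on the coordinate side: `(fc⁻¹ z)_a(x) = z·legV x a`. [cite: Balaban1983Higgs3, (1.19) p.416] -/
theorem fc_symm_apply (z : Crd P k N → ℝ) (x : HiggsLattice.Site P k) (a : Fin N) :
    (fc P k N).symm z x a = z ⬝ᵥ legV x a := by
  rw [← dotProduct_legV ((fc P k N).symm z) x a, LinearEquiv.apply_symm_apply]

/-- `⟨χ, ε^{−d}(δ_x ⊗ e_a)⟩ = χ_a(x)` for the scalar product (I.1.5). [cite: Balaban1982Higgs1, (1.5) p.604] -/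
theorem siteInner_delta (χ : ScalarField P k N) (x : HiggsLattice.Site P k) (a : Fin N) :
    siteInner χ ((P.mesh k ^ P.d)⁻¹ • (Pi.single x (EuclideanSpace.single a (1 : ℝ)) : ScalarField P k N)) = χ x a := by
  have hη : P.mesh k ^ P.d ≠ 0 := (pow_pos (P.mesh_pos k) _).ne'
  rw [siteInner_smul_right, siteInner, ← Finset.mul_sum, sum_inner_single, ← mul_assoc, inv_mul_cancel₀ hη, one_mul]

/-- **The free propagator** `C₀(x,a; x′,b) := ⟨φ_a(x)φ_b(x′)⟩₀`, the two-point function of the unperturbed measure (the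
zeroth-order term of (1.19); «C^ε_0 … internal indices understood»). [cite: Balaban1983Higgs3, (1.21) p.416] -/
def prop0 (P : HiggsLattice.Params) (k N : ℕ) (C : ChargeData N) (msq mu0sq : ℝ)
    (x : HiggsLattice.Site P k) (a : Fin N) (x' : HiggsLattice.Site P k) (b : Fin N) : ℝ :=
  expect0 P k N C msq mu0sq fun φ => φ x a * φ x' b

/-- `C₀` is symmetric. [cite: Balaban1983Higgs3, (1.21) p.416] -/
theorem prop0_symm (C : ChargeData N) (msq mu0sq : ℝ) (x : HiggsLattice.Site P k) (a : Fin N)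
    (x' : HiggsLattice.Site P k) (b : Fin N) :
    prop0 P k N C msq mu0sq x a x' b = prop0 P k N C msq mu0sq x' b x a := by
  unfold prop0 expect0
  simp_rw [mul_comm]

/-- **At `e = 0` the propagator is the covariance of the free scalar Gaussian**: `C₀(x,a;x′,b) = ⟨precMat⁻¹·legV x a, legV x′ b⟩`
(Wick with two legs). [cite: Balaban1983Higgs3, (1.21) p.416] -/
theorem prop0_eq_inv (C : ChargeData N) (he : C.e = 0) {msq mu0sq : ℝ} (hm : 0 < msq) (hmu : 0 < mu0sq)
    (x : HiggsLattice.Site P k) (a : Fin N) (x' : HiggsLattice.Site P k) (b : Fin N) :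
    prop0 P k N C msq mu0sq x a x' b = ((precMat (P := P) (k := k) C msq)⁻¹ *ᵥ legV x a) ⬝ᵥ legV x' b := by
  rw [prop0, expect0_eq_gexp C he hm hmu]
  have h : (fun z : Crd P k N → ℝ => (fc P k N).symm z x a * (fc P k N).symm z x' b)
      = fun z => (z ⬝ᵥ legV x a) * (z ⬝ᵥ legV x' b) := by
    funext z
    rw [fc_symm_apply, fc_symm_apply]
  rw [h, gexp_two_legs (precMat_posDef C hm)]

/-- The column `C₀(·; x′, b)` of the propagator as a scalar field: `fc⁻¹(precMat⁻¹·legV x′ b)`.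
[cite: Balaban1983Higgs3, (1.21) p.416] -/
def propCol (C : ChargeData N) (msq : ℝ) (x' : HiggsLattice.Site P k) (b : Fin N) : ScalarField P k N :=
  (fc P k N).symm ((precMat (P := P) (k := k) C msq)⁻¹ *ᵥ legV x' b)

/-- The components of the column are the propagator entries: `propCol x′ b x a = C₀(x,a;x′,b)`.
[cite: Balaban1983Higgs3, (1.21) p.416] -/
theorem propCol_apply (C : ChargeData N) (he : C.e = 0) {msq mu0sq : ℝ} (hm : 0 < msq) (hmu : 0 < mu0sq)
    (x' : HiggsLattice.Site P k) (b : Fin N) (x : HiggsLattice.Site P k) (a : Fin N) :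
    propCol C msq x' b x a = prop0 P k N C msq mu0sq x a x' b := by
  rw [propCol, fc_symm_apply, prop0_symm, prop0_eq_inv C he hm hmu]

/-- `(−Δ^ε_0 + m²)` is injective for `m² > 0`. [cite: Balaban1983Higgs3, (1.21) p.416] -/
theorem freeOp_injective (C : ChargeData N) {msq : ℝ} (hm : 0 < msq) :
    Function.Injective (freeOp (P := P) (k := k) C msq) := by
  refine (injective_iff_map_eq_zero _).2 fun φ hφ => ?_
  have h := siteInner_freeOp_self_ge C msq φ
  rw [hφ, HiggsFluctMeasureCov.siteInner_zero_right] at h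
  have hnn := siteInner_self_nonneg φ
  have h0 : siteInner φ φ = 0 := by
    by_contra hne
    have hpos : 0 < siteInner φ φ := lt_of_le_of_ne hnn (Ne.symm hne)
    nlinarith [mul_pos hm hpos]
  exact eq_zero_of_siteInner_self_eq_zero φ h0

/-- **THE GREEN'S-FUNCTION EQUATION `C^ε_0 = (−Δ^ε_0 + m²)^{−1}`**: the column `C₀(·; x′, b)` solves
`(−Δ^ε_0 + m²)ψ = ε^{−d}·δ_{x′} ⊗ e_b` (the kernel of the inverse for the `ε^d`-weighted scalar product (I.1.5)), and is
its unique solution (`freeOp_injective`). [cite: Balaban1983Higgs3, (1.21) p.416] -/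
theorem freeOp_propCol (C : ChargeData N) {msq : ℝ} (hm : 0 < msq) (x' : HiggsLattice.Site P k) (b : Fin N) :
    freeOp C msq (propCol C msq x' b)
      = (P.mesh k ^ P.d)⁻¹ • (Pi.single x' (EuclideanSpace.single b (1 : ℝ)) : ScalarField P k N) := by
  set ψ := propCol (P := P) (k := k) C msq x' b with hψ
  set δ : ScalarField P k N := (P.mesh k ^ P.d)⁻¹ • (Pi.single x' (EuclideanSpace.single b (1 : ℝ)) : ScalarField P k N)
  have hdet : IsUnit (precMat (P := P) (k := k) C msq).det :=
    isUnit_iff_ne_zero.2 (precMat_posDef C hm).det_pos.ne'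
  have hweak : ∀ χ : ScalarField P k N, siteInner χ (freeOp C msq ψ) = siteInner χ δ := by
    intro χ
    rw [siteInner_delta, ← dotProduct_precMat_mulVec, hψ, propCol, LinearEquiv.apply_symm_apply, mulVec_mulVec,
      mul_nonsing_inv _ hdet, one_mulVec, dotProduct_legV]
  have hzero : siteInner (freeOp C msq ψ - δ) (freeOp C msq ψ - δ) = 0 := by
    rw [HiggsFluctMeasurePos.siteInner_sub_right, hweak, sub_self]
  exact sub_eq_zero.1 (eq_zero_of_siteInner_self_eq_zero _ hzero)

/-! ## §5 The vertices (1.6)/(1.7) and the observable as polynomial clusters; the coefficients of (1.19) as sums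
over connected graphs -/

section Graphs

/-- **The colours**: `inl ()` = the observable `φ_a(x)φ_b(x′)` (2 legs); `inr (inl (y, c, c′))` = the quartic vertex
(1.6) at the point `y` with internal indices `c, c′`, monomial `φ_c(y)φ_c(y)φ_{c′}(y)φ_{c′}(y)` (4 legs);
`inr (inr (y, c))` = the mass vertex (1.7) at `y` with index `c`, monomial `φ_c(y)φ_c(y)` (2 legs).
[cite: Balaban1983Higgs3, (1.6)-(1.7) p.413, (1.20) p.416] -/
abbrev Colour (P : HiggsLattice.Params) (k N : ℕ) : Type :=
  Unit ⊕ ((HiggsLattice.Site P k × Fin N × Fin N) ⊕ (HiggsLattice.Site P k × Fin N))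

/-- The number of legs of a colour (2, 4, 2). [cite: Balaban1983Higgs3, (1.6)-(1.7) p.413] -/
def cdeg : Colour P k N → ℕ
  | .inl _ => 2
  | .inr (.inl _) => 4
  | .inr (.inr _) => 2

/-- The position and internal index of the `i`-th leg of a colour (observable `φ_a(x)φ_b(x′)`).
[cite: Balaban1983Higgs3, (1.6)-(1.7) p.413] -/
def legPos (a b : Fin N) (x x' : HiggsLattice.Site P k) : Colour P k N → ℕ → HiggsLattice.Site P k × Fin N
  | .inl _, i => if i = 0 then (x, a) else (x', b)
  | .inr (.inl (y, c, c')), i => if i < 2 then (y, c) else (y, c')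
  | .inr (.inr (y, c)), _ => (y, c)

/-- The leg vectors of the colours: the `i`-th leg of colour `κ` is the field component at `legPos κ i`.
[cite: Balaban1983Higgs3, (1.6)-(1.7) p.413] -/
def clv (a b : Fin N) (x x' : HiggsLattice.Site P k) (κ : Colour P k N) (i : ℕ) : Crd P k N → ℝ :=
  legV (legPos a b x x' κ i).1 (legPos a b x x' κ i).2

/-- The coefficients: `1` for the observable cluster (`none`), `−λε^d` for a quartic colour and `−½δm²ε^d` for a mass
colour of a vertex cluster (`some i`; the vertices enter as `−V`). [cite: Balaban1983Higgs3, (1.20) p.416] -/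
def ccoef (ηd lam dm2 : ℝ) {n : ℕ} : Option (Fin n) → Colour P k N → ℝ
  | none, _ => 1
  | some _, .inl _ => 0
  | some _, .inr (.inl _) => -(ηd * lam)
  | some _, .inr (.inr _) => -(ηd * (dm2 / 2))

/-- The colour ranges: the observable cluster has the single colour `inl ()`, a vertex cluster ranges over all quartic
and mass colours (positions `y ∈ T_ε`, internal indices). [cite: Balaban1983Higgs3, (1.20) p.416] -/
def cK {n : ℕ} : Option (Fin n) → Finset (Colour P k N)
  | none => {Sum.inl ()}
  | some _ => Finset.univ.map ⟨Sum.inr, Sum.inr_injective⟩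

variable (a b : Fin N) (x x' : HiggsLattice.Site P k)

/-- The observable cluster is `(z·legV x a)(z·legV x′ b)`. [cite: Balaban1983Higgs3, (1.19) p.416] -/
theorem clusterVar_none (ηd lam dm2 : ℝ) {n : ℕ} (z : Crd P k N → ℝ) :
    clusterVar (cK (P := P) (k := k) (N := N) (n := n)) (ccoef ηd lam dm2) cdeg (clv a b x x') none z
      = (z ⬝ᵥ legV x a) * (z ⬝ᵥ legV x' b) := by
  rw [clusterVar, cK, Finset.sum_singleton, ccoef, one_mul, legProd]
  show ∏ i : Fin 2, z ⬝ᵥ clv a b x x' (Sum.inl ()) i = _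
  rw [Fin.prod_univ_two]
  rfl

/-- `‖v‖² = Σ_c v_c²` on `ℝ^N`. [folklore] [cite: Balaban1982Higgs1, (1.5) p.604] -/
theorem norm_sq_eq_sum (v : E N) : ‖v‖ ^ 2 = ∑ c, v c ^ 2 := by
  rw [EuclideanSpace.norm_sq_eq]
  exact Finset.sum_congr rfl fun c _ => by rw [Real.norm_eq_abs, sq_abs]

/-- **A vertex cluster, read on the field side, is `−V`**: `Σ_{colours} coef · monomial = −Σ_yε^d(λ|φ(y)|⁴ + ½δm²|φ(y)|²)`.
[cite: Balaban1983Higgs3, (1.20) p.416] -/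
theorem clusterVar_some (lam dm2 : ℝ) {n : ℕ} (i : Fin n) (φ : ScalarField P k N) :
    clusterVar (cK (P := P) (k := k) (N := N) (n := n)) (ccoef (P.mesh k ^ P.d) lam dm2) cdeg (clv a b x x')
        (some i) (fc P k N φ)
      = -vertices P k lam dm2 φ := by
  rw [clusterVar, cK, Finset.sum_map, Fintype.sum_sum_type]
  have h4 : ∀ q : HiggsLattice.Site P k × Fin N × Fin N,
      ccoef (P := P) (k := k) (N := N) (P.mesh k ^ P.d) lam dm2 (some i) (Sum.inr (Sum.inl q))
        * legProd cdeg (clv a b x x') (Sum.inr (Sum.inl q)) (fc P k N φ)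
      = -(P.mesh k ^ P.d * lam) * (φ q.1 q.2.1 ^ 2 * φ q.1 q.2.2 ^ 2) := by
    rintro ⟨y, c, c'⟩
    rw [ccoef, legProd]
    show -(P.mesh k ^ P.d * lam) * ∏ j : Fin 4, fc P k N φ ⬝ᵥ clv a b x x' (Sum.inr (Sum.inl (y, c, c'))) j = _
    rw [Fin.prod_univ_four]
    show -(P.mesh k ^ P.d * lam) * (fc P k N φ ⬝ᵥ legV y c * (fc P k N φ ⬝ᵥ legV y c) * (fc P k N φ ⬝ᵥ legV y c')
      * (fc P k N φ ⬝ᵥ legV y c')) = _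
    rw [dotProduct_legV, dotProduct_legV]
    ring
  have h2 : ∀ q : HiggsLattice.Site P k × Fin N,
      ccoef (P := P) (k := k) (N := N) (P.mesh k ^ P.d) lam dm2 (some i) (Sum.inr (Sum.inr q))
        * legProd cdeg (clv a b x x') (Sum.inr (Sum.inr q)) (fc P k N φ)
      = -(P.mesh k ^ P.d * (dm2 / 2)) * φ q.1 q.2 ^ 2 := by
    rintro ⟨y, c⟩
    rw [ccoef, legProd]
    show -(P.mesh k ^ P.d * (dm2 / 2)) * ∏ j : Fin 2, fc P k N φ ⬝ᵥ clv a b x x' (Sum.inr (Sum.inr (y, c))) j = _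
    rw [Fin.prod_univ_two]
    simp only [clv, legPos, dotProduct_legV]
    ring
  simp only [Function.Embedding.coeFn_mk, h4, h2]
  have hy : ∀ y : HiggsLattice.Site P k,
      -(P.mesh k ^ P.d * (lam * ‖φ y‖ ^ 4 + dm2 / 2 * ‖φ y‖ ^ 2))
        = -(P.mesh k ^ P.d * lam) * (∑ c, ∑ c', φ y c ^ 2 * φ y c' ^ 2)
          + -(P.mesh k ^ P.d * (dm2 / 2)) * ∑ c, φ y c ^ 2 := by
    intro y
    rw [show (4 : ℕ) = 2 * 2 from rfl, pow_mul, norm_sq_eq_sum, sq, Finset.sum_mul_sum]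
    ring
  rw [vertices, ← Finset.sum_neg_distrib]
  simp only [Fintype.sum_prod_type]
  rw [← Finset.sum_add_distrib]
  refine Finset.sum_congr rfl fun y _ => ?_
  rw [hy y]
  simp only [Finset.mul_sum]


/-- The pinned observable times powers of `−V`, read off a vertex family `Q ⊆ Option (Fin n)`:
`F^{[none ∈ Q]}·(−V)^{#(Q ∖ {none})}`. [cite: Balaban1983Higgs3, (1.21) p.416] -/
def obsPow (lam dm2 : ℝ) {n : ℕ} (Q : Finset (Option (Fin n))) (φ : ScalarField P k N) : ℝ :=
  (if none ∈ Q then φ x a * φ x' b else 1) * (-vertices P k lam dm2 φ) ^ (Q.filter (· ≠ none)).card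

omit a b x x' in
/-- `∏_{j∈Q} (u if j = none, v otherwise) = u^{[none∈Q]}·v^{#(Q∖{none})}`. [folklore] [cite: Mastropietro2008, §2.3 (2.36)-(2.38)] -/
theorem prod_option_elim {R : Type*} [CommMonoid R] {α : Type*} [DecidableEq α] (Q : Finset (Option α)) (u v : R) :
    ∏ j ∈ Q, j.elim u (fun _ => v) = (if none ∈ Q then u else 1) * v ^ (Q.filter (· ≠ none)).card := by
  have h1 : ∏ j ∈ Q.filter (fun j => j = none), j.elim u (fun _ => v) = if none ∈ Q then u else 1 := by
    rw [Finset.prod_filter, Finset.prod_ite_eq']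
    rfl
  have h2 : ∏ j ∈ Q.filter (fun j => ¬ j = none), j.elim u (fun _ => v) = v ^ (Q.filter (· ≠ none)).card :=
    Finset.prod_eq_pow_card fun j hj => by
      obtain ⟨-, hj⟩ := Finset.mem_filter.1 hj
      obtain ⟨i, rfl⟩ := Option.ne_none_iff_exists'.1 hj
      rfl
  rw [← Finset.prod_filter_mul_prod_filter_not Q (fun j => j = none), h1, h2]

/-- **The product of the clusters over a vertex family, on the field side**: `Π_{j∈Q} X_j(fc φ) = F(φ)^{[none∈Q]}·(−V(φ))^{#(Q∖{none})}`.
[cite: Balaban1983Higgs3, (1.21) p.416] -/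
theorem prod_clusterVar_fc (lam dm2 : ℝ) {n : ℕ} (Q : Finset (Option (Fin n))) (φ : ScalarField P k N) :
    ∏ j ∈ Q, clusterVar (cK (P := P) (k := k) (N := N) (n := n)) (ccoef (P.mesh k ^ P.d) lam dm2) cdeg
        (clv a b x x') j (fc P k N φ)
      = obsPow a b x x' lam dm2 Q φ := by
  have h : ∀ j : Option (Fin n), clusterVar (cK (P := P) (k := k) (N := N) (n := n)) (ccoef (P.mesh k ^ P.d) lam dm2)
      cdeg (clv a b x x') j (fc P k N φ) = j.elim (φ x a * φ x' b) (fun _ => -vertices P k lam dm2 φ) := by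
    rintro (_ | i)
    · rw [clusterVar_none, dotProduct_legV, dotProduct_legV]; rfl
    · rw [clusterVar_some]; rfl
  rw [Finset.prod_congr rfl fun j _ => h j, prod_option_elim, obsPow]

/-- **The cluster moments ARE the unperturbed expectations** (`e = 0`): `⟨Π_{j∈Q} X_j⟩_Gauss = ⟨F^{[none∈Q]}(−V)^{#(Q∖{none})}⟩₀`.
[cite: Balaban1983Higgs3, (1.21) p.416] -/
theorem jmoment_eq_expect0 (C : ChargeData N) (he : C.e = 0) {msq mu0sq : ℝ} (hm : 0 < msq) (hmu : 0 < mu0sq)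
    (lam dm2 : ℝ) {n : ℕ} (Q : Finset (Option (Fin n))) :
    jmoment (precMat C msq) (cK (P := P) (k := k) (N := N) (n := n)) (ccoef (P.mesh k ^ P.d) lam dm2) cdeg
        (clv a b x x') Q
      = expect0 P k N C msq mu0sq (obsPow a b x x' lam dm2 Q) := by
  rw [jmoment, expect0_eq_gexp C he hm hmu]
  congr 1
  funext z
  rw [← prod_clusterVar_fc a b x x' lam dm2 Q ((fc P k N).symm z), LinearEquiv.apply_symm_apply]

/-- The tilted moments at `t = 0` are plain moments. [cite: Balaban1983Higgs3, (1.21) p.416] -/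
theorem tiltMoment_zero {Ω : Type*} [MeasurableSpace Ω] (ν : Measure Ω) (F V : Ω → ℝ) (m : ℕ) :
    tiltMoment ν F V m 0 = ∫ σ, F σ * (-V σ) ^ m ∂ν := by
  unfold tiltMoment
  refine integral_congr_ae (ae_of_all _ fun σ => ?_)
  simp

/-- **The pinned moments of BRICK 4 at `t = 0` ARE the unperturbed expectations** `⟨F^{[none∈Q]}(−V)^{#(Q∖{none})}⟩₀`.
[cite: Balaban1983Higgs3, (1.21) p.416] -/
theorem pinnedMoments_eq_expect0 (C : ChargeData N) {msq mu0sq lam : ℝ} (hm : 0 < msq) (hmu : 0 < mu0sq)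
    (hlam : 0 < lam) (dm2 : ℝ) {n : ℕ} (Q : Finset (Option (Fin n))) :
    pinnedMoments none
        (tiltMoment (freeMeasure P k N C msq mu0sq) (fun Φ => Φ.2 x a * Φ.2 x' b)
          (fun Φ => vertices P k lam dm2 Φ.2) 0)
        (tiltZ (freeMeasure P k N C msq mu0sq) (fun Φ => vertices P k lam dm2 Φ.2)) (Set.Ici 0) 0 Q
      = expect0 P k N C msq mu0sq (obsPow a b x x' lam dm2 Q) := by
  rw [(tiltData_freeMeasure_twoPointObs hm hmu hlam C dm2 a b x x').pinnedMoments_eq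
    (tiltData_freeMeasure_one hm hmu hlam C dm2) le_rfl none Q, expect0, tiltZ, tiltMoment_zero, tiltMoment_zero,
    tiltMoment_zero]
  simp only [pow_zero, mul_one]
  by_cases hn : none ∈ Q
  · rw [if_pos hn]
    have hcard : Q.card - 1 = (Q.filter (· ≠ none)).card := by
      rw [Finset.filter_ne', Finset.card_erase_of_mem hn]
    simp only [obsPow, if_pos hn, hcard]
  · rw [if_neg hn]
    have hcard : Q.card = (Q.filter (· ≠ none)).card := by
      rw [Finset.filter_true_of_mem fun j hj => ?_]
      rintro rfl
      exact hn hj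
    simp only [obsPow, if_neg hn, hcard, one_mul]

variable {a b x x'}

/-- **The lines of the graphs are free propagators**: the weight of a pair of legs `{l, l′}` is
`C₀(position/index of l; position/index of l′) = ⟨φ_{c_l}(y_l)φ_{c_{l′}}(y_{l′})⟩₀`; blocks that are not pairs weigh `0`
(`B3GaussianPerturbationGraphs.pairW_of_card_ne_two`). [cite: Balaban1983Higgs3, (1.21) p.416] -/
theorem pairW_legs (C : ChargeData N) (he : C.e = 0) {msq mu0sq : ℝ} (hm : 0 < msq) (hmu : 0 < mu0sq)
    {n : ℕ} (z : Option (Fin n) → Colour P k N) {l l' : Leg cdeg z} (h : l ≠ l') :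
    pairW (precMat (P := P) (k := k) C msq) (legVec cdeg (clv a b x x') z) {l, l'}
      = prop0 P k N C msq mu0sq (legPos a b x x' (z l.1) l.2).1 (legPos a b x x' (z l.1) l.2).2
          (legPos a b x x' (z l'.1) l'.2).1 (legPos a b x x' (z l'.1) l'.2).2 := by
  rw [pairW_pair (precMat_posDef C hm) _ h, prop0_eq_inv C he hm hmu]
  rfl

end Graphs

/-! ## §6 THE HEADLINE: the vertex coefficients of (1.19) at `e = 0` as sums over CONNECTED Feynman graphs -/

section Headline

open B1Sect1Statements

variable {D : ModelData} {P : HiggsLattice.Params}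

/-- Order zero: `G^ε_t|_{t=0} = C₀(x,a;x′,b)` — the free propagator is the unperturbed two-point function.
[cite: Balaban1983Higgs3, (1.21) p.416] -/
theorem twoPointFamily_zero (a b : Fin D.N) (x x' : HiggsLattice.Site P 0) :
    twoPointFamily D P a b x x' 0 = prop0 P 0 D.N D.C D.msq D.mu0sq x a x' b := by
  rw [twoPointFamily, tiltExpect, tiltZ, tiltMoment_zero, tiltMoment_zero, prop0, expect0]
  simp only [pow_zero, mul_one]

/-- **«THE FUNCTION `G^ε` HAS A PERTURBATIVE EXPANSION … A GRAPHICAL DESCRIPTION OF THE SAME TYPE AS IN (1.17)»** — at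
`e = 0` (`m² > 0`, `μ₀² > 0`, `λ > 0`), for every order `n`, the `n`-th vertex coefficient of the two-point function (1.19)
(`= (d/dt)ⁿG^ε_t|_{t=0⁺}`, BRICK 4) is the sum over the colourings `z` of the `n` vertices (each a quartic vertex
(1.6) `−λε^d φ_c(y)²φ_{c′}(y)²` or a mass vertex (1.7) `−½δm²ε^d φ_c(y)²`, the observable `φ_a(x)φ_b(x′)` being the
cluster `none`) of `Π_j coef · Σ_{CONNECTED Wick pairings τ of all the legs} Π_{{l,l′}∈τ} C₀(l; l′)` — the connected
Feynman graphs of the expansion with vertices (1.6), (1.7), two external legs and lines `C^ε_0` (`pairW_legs`,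
`freeOp_propCol`); the disconnected (vacuum) graphs have cancelled against `Z^ε`.
[cite: Balaban1983Higgs3, (1.19)-(1.21) p.416] [cite: Mastropietro2008, §2.3 (2.38)] -/
theorem iteratedDerivWithin_twoPointFamily_eq_sum_connected (he : D.C.e = 0) (hm : 0 < D.msq) (hmu : 0 < D.mu0sq)
    (hlam : 0 < D.lam) (a b : Fin D.N) (x x' : HiggsLattice.Site P 0) (n : ℕ) :
    iteratedDerivWithin n (twoPointFamily D P a b x x') (Set.Ici 0) 0
      = ∑ z ∈ Fintype.piFinset (cK (P := P) (k := 0) (N := D.N) (n := n)),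
          (∏ j, ccoef (P.mesh 0 ^ P.d) D.lam (D.δmsq P.ε D.C.e D.lam) j (z j)) *
            ∑ g ∈ (diags (Sigma.fst : Leg cdeg z → Option (Fin n))
                ((Finset.univ : Finset (Option (Fin n))).map Function.Embedding.some)).filter
                (IsConn (Sigma.fst : Leg cdeg z → Option (Fin n))
                  ((Finset.univ : Finset (Option (Fin n))).map Function.Embedding.some)),
              ∏ B ∈ g.2, pairW (precMat (P := P) (k := 0) D.C D.msq) (legVec cdeg (clv a b x x') z) B := by
  have hW : (((Finset.univ : Finset (Fin n)).map Function.Embedding.some).card : ℕ) = n := by simp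
  have hnot : none ∉ (Finset.univ : Finset (Fin n)).map Function.Embedding.some := by simp
  have hins : insert none ((Finset.univ : Finset (Fin n)).map Function.Embedding.some)
      = (Finset.univ : Finset (Option (Fin n))) := by
    ext j
    cases j <;> simp
  rw [← hW, iteratedDerivWithin_twoPointFamily_eq_ursellOf hm hmu hlam a b x x' le_rfl hnot, hins, hW]
  have hfun : pinnedMoments none
      (tiltMoment (freeMeasure P 0 D.N D.C D.msq D.mu0sq) (fun Φ => Φ.2 x a * Φ.2 x' b)
        (fun Φ => vertices P 0 D.lam (D.δmsq P.ε D.C.e D.lam) Φ.2) 0)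
      (tiltZ (freeMeasure P 0 D.N D.C D.msq D.mu0sq) (fun Φ => vertices P 0 D.lam (D.δmsq P.ε D.C.e D.lam) Φ.2))
      (Set.Ici 0) 0
      = jmoment (precMat (P := P) (k := 0) D.C D.msq) (cK (P := P) (k := 0) (N := D.N) (n := n))
          (ccoef (P.mesh 0 ^ P.d) D.lam (D.δmsq P.ε D.C.e D.lam)) cdeg (clv a b x x') := by
    funext Q
    rw [pinnedMoments_eq_expect0 a b x x' D.C hm hmu hlam _ Q, jmoment_eq_expect0 a b x x' D.C he hm hmu]
  rw [hfun, ursellOf_jmoment_univ (precMat_posDef D.C hm) fun _ => Sum.inl ()]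

end Headline

/-! ## §7 «internal indices understood»: the propagator is diagonal in the internal index and the diagonal does not
depend on it, `C₀(x,a;x′,b) = δ_{ab}C^ε_0(x,x′)` -/

section Indices

/-- `−Δ^ε_0 + m²` componentwise: `((−Δ^ε_0+m²)φ)(x)_c = ε^{−2}Σ_μ[(φ_c(x) − φ_c(x+εe_μ)) + (φ_c(x) − φ_c(x−εe_μ))] + m²φ_c(x)`
(at `A = 0`, `U(0) = 1`: the operator acts on each internal component separately). [cite: Balaban1982Higgs1, (1.11) p.605] -/
theorem freeOp_apply_apply (C : ChargeData N) (msq : ℝ) (φ : ScalarField P k N) (x : HiggsLattice.Site P k) (c : Fin N) :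
    freeOp C msq φ x c = ((P.mesh k)⁻¹ ^ 2) * ∑ μ : Fin P.d,
        ((φ x c - φ (x.shift μ) c) + (φ x c - φ (x.unshift μ) c)) + msq * φ x c := by
  rw [freeOp_apply, Pi.add_apply, Pi.smul_apply, B1Eq31Concrete.covLaplacianN_univ_apply]
  simp only [Pi.zero_apply, neg_zero, ChargeData.U_zero, one_apply_eq_self, WithLp.ofLp_add,
    WithLp.ofLp_smul, WithLp.ofLp_sum, WithLp.ofLp_sub, Pi.add_apply, Pi.smul_apply, Finset.sum_apply, Pi.sub_apply,
    smul_eq_mul]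

/-- Keeping only the internal component `c` of a field. [cite: Balaban1983Higgs3, (1.21) p.416] -/
def compProj (c : Fin N) (φ : ScalarField P k N) : ScalarField P k N := fun y => EuclideanSpace.single c (φ y c)

/-- [cite: Balaban1983Higgs3, (1.21) p.416] -/
theorem compProj_apply (c : Fin N) (φ : ScalarField P k N) (y : HiggsLattice.Site P k) (d : Fin N) :
    compProj c φ y d = if d = c then φ y c else 0 := by
  rw [compProj, PiLp.single_apply]

/-- `−Δ^ε_0 + m²` commutes with keeping one internal component. [cite: Balaban1983Higgs3, (1.21) p.416] -/
theorem freeOp_compProj (C : ChargeData N) (msq : ℝ) (c : Fin N) (φ : ScalarField P k N) :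
    freeOp C msq (compProj c φ) = compProj c (freeOp C msq φ) := by
  funext y
  ext d
  simp only [freeOp_apply_apply, compProj_apply]
  by_cases h : d = c
  · subst h
    simp
  · simp [h]

/-- Exchanging two internal components of a field. [cite: Balaban1983Higgs3, (1.21) p.416] -/
def compSwap (a b : Fin N) (φ : ScalarField P k N) : ScalarField P k N :=
  fun y => WithLp.toLp 2 fun d => φ y (Equiv.swap a b d)

/-- [cite: Balaban1983Higgs3, (1.21) p.416] -/
theorem compSwap_apply (a b : Fin N) (φ : ScalarField P k N) (y : HiggsLattice.Site P k) (d : Fin N) :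
    compSwap a b φ y d = φ y (Equiv.swap a b d) := rfl

/-- `−Δ^ε_0 + m²` commutes with exchanging internal components. [cite: Balaban1983Higgs3, (1.21) p.416] -/
theorem freeOp_compSwap (C : ChargeData N) (msq : ℝ) (a b : Fin N) (φ : ScalarField P k N) :
    freeOp C msq (compSwap a b φ) = compSwap a b (freeOp C msq φ) := by
  funext y
  ext d
  simp only [freeOp_apply_apply, compSwap_apply]

/-- **`C₀` is diagonal in the internal index**: `C₀(x,a;x′,b) = 0` for `a ≠ b` (`e = 0`). [cite: Balaban1983Higgs3, (1.21) p.416] -/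
theorem prop0_eq_zero_of_ne (C : ChargeData N) (he : C.e = 0) {msq mu0sq : ℝ} (hm : 0 < msq) (hmu : 0 < mu0sq)
    (x : HiggsLattice.Site P k) {a : Fin N} (x' : HiggsLattice.Site P k) {b : Fin N} (hab : a ≠ b) :
    prop0 P k N C msq mu0sq x a x' b = 0 := by
  have hfix : compProj b (propCol (P := P) (k := k) C msq x' b) = propCol C msq x' b := by
    apply freeOp_injective C hm
    rw [freeOp_compProj, freeOp_propCol C hm]
    funext y
    ext d
    rw [compProj_apply]
    simp only [Pi.smul_apply, PiLp.smul_apply, smul_eq_mul]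
    by_cases hd : d = b
    · subst hd
      rw [if_pos rfl]
    · rw [if_neg hd]
      by_cases hy : y = x'
      · subst hy
        rw [Pi.single_eq_same, PiLp.single_apply, if_neg hd, mul_zero]
      · rw [Pi.single_eq_of_ne hy, PiLp.zero_apply, mul_zero]
  rw [← propCol_apply C he hm hmu, ← hfix, compProj_apply, if_neg hab]

/-- **The diagonal of `C₀` does not depend on the internal index**: `C₀(x,a;x′,a) = C₀(x,b;x′,b)` (`e = 0`).
[cite: Balaban1983Higgs3, (1.21) p.416] -/
theorem prop0_diag_eq (C : ChargeData N) (he : C.e = 0) {msq mu0sq : ℝ} (hm : 0 < msq) (hmu : 0 < mu0sq)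
    (x : HiggsLattice.Site P k) (x' : HiggsLattice.Site P k) (a b : Fin N) :
    prop0 P k N C msq mu0sq x a x' a = prop0 P k N C msq mu0sq x b x' b := by
  have hswap : compSwap a b (propCol (P := P) (k := k) C msq x' b) = propCol C msq x' a := by
    apply freeOp_injective C hm
    rw [freeOp_compSwap, freeOp_propCol C hm, freeOp_propCol C hm]
    funext y
    ext d
    rw [compSwap_apply]
    simp only [Pi.smul_apply, PiLp.smul_apply, smul_eq_mul]
    by_cases hy : y = x'
    · subst hy
      rw [Pi.single_eq_same, Pi.single_eq_same, PiLp.single_apply, PiLp.single_apply]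
      congr 1
      by_cases hda : d = a
      · subst hda
        rw [Equiv.swap_apply_left, if_pos rfl, if_pos rfl]
      · rw [if_neg hda]
        by_cases hdb : d = b
        · subst hdb
          rw [Equiv.swap_apply_right, if_neg (Ne.symm hda)]
        · rw [Equiv.swap_apply_of_ne_of_ne hda hdb, if_neg hdb]
    · rw [Pi.single_eq_of_ne hy, Pi.single_eq_of_ne hy]
      rfl
  rw [← propCol_apply C he hm hmu x' a x a, ← hswap, compSwap_apply, Equiv.swap_apply_left,
    propCol_apply C he hm hmu]

/-- **«internal indices understood»**: `C₀(x,a;x′,b) = δ_{ab}·C₀(x,a;x′,a)` (`e = 0`). [cite: Balaban1983Higgs3, (1.21) p.416] -/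
theorem prop0_eq_ite (C : ChargeData N) (he : C.e = 0) {msq mu0sq : ℝ} (hm : 0 < msq) (hmu : 0 < mu0sq)
    (x : HiggsLattice.Site P k) (a : Fin N) (x' : HiggsLattice.Site P k) (b : Fin N) :
    prop0 P k N C msq mu0sq x a x' b = if a = b then prop0 P k N C msq mu0sq x a x' a else 0 := by
  split_ifs with h
  · rw [h]
  · exact prop0_eq_zero_of_ne C he hm hmu x x' h

end Indices

/-! ## §8 (v1.1) The coefficients as polynomials in `(λ, δm²)`: regrouping the colourings by the number of quartic vertices -/

section Polynomial

variable {P : HiggsLattice.Params} {k N : ℕ}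

/-- A colour is quartic (a vertex (1.6)) or not. [cite: Balaban1983Higgs3, (1.6) p.413] -/
def isQuartic : Colour P k N → Bool
  | .inr (.inl _) => true
  | _ => false

/-- The number of quartic vertices (1.6) of a colouring of `n` vertices (the others are mass vertices (1.7)).
[cite: Balaban1983Higgs3, (1.21) p.416] -/
def qCount {n : ℕ} (z : Option (Fin n) → Colour P k N) : ℕ :=
  (univ.filter fun i : Fin n => isQuartic (z (some i)) = true).card

/-- [cite: Balaban1983Higgs3, (1.21) p.416] -/
theorem qCount_le {n : ℕ} (z : Option (Fin n) → Colour P k N) : qCount z ≤ n :=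
  (card_filter_le _ _).trans (by simp)

/-- A vertex colour in the range `cK (some i)` is a quartic or a mass colour, with coefficient `−λε^d` resp. `−½δm²ε^d`.
[cite: Balaban1983Higgs3, (1.20) p.416] -/
theorem ccoef_some_eq (ηd lam dm2 : ℝ) {n : ℕ} (i : Fin n) {κ : Colour P k N}
    (hκ : κ ∈ cK (P := P) (k := k) (N := N) (some i)) :
    ccoef (P := P) (k := k) (N := N) ηd lam dm2 (some i) κ
      = if isQuartic κ = true then -(ηd * lam) else -(ηd * (dm2 / 2)) := by
  rw [cK, mem_map] at hκ
  obtain ⟨c, -, rfl⟩ := hκ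
  rcases c with q | m
  · rfl
  · rfl

/-- **The coefficient of a colouring is a monomial**: `Π_j ccoef_j(z_j) = (−λε^d)^{q(z)}·(−½δm²ε^d)^{n−q(z)}`.
[cite: Balaban1983Higgs3, (1.21) p.416] -/
theorem prod_ccoef_eq (ηd lam dm2 : ℝ) {n : ℕ} {z : Option (Fin n) → Colour P k N}
    (hz : z ∈ Fintype.piFinset (cK (P := P) (k := k) (N := N) (n := n))) :
    ∏ j, ccoef (P := P) (k := k) (N := N) ηd lam dm2 j (z j)
      = (-(ηd * lam)) ^ qCount z * (-(ηd * (dm2 / 2))) ^ (n - qCount z) := by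
  have hzi : ∀ i : Fin n, z (some i) ∈ cK (P := P) (k := k) (N := N) (some i) :=
    fun i => Fintype.mem_piFinset.1 hz (some i)
  rw [Fintype.prod_option]
  have h0 : ccoef (P := P) (k := k) (N := N) (n := n) ηd lam dm2 none (z none) = 1 := rfl
  rw [h0, one_mul, prod_congr rfl fun i _ => ccoef_some_eq ηd lam dm2 i (hzi i), prod_ite, prod_const, prod_const,
    qCount]
  congr 2
  have h := Finset.card_filter_add_card_filter_not (s := (univ : Finset (Fin n)))
    (fun i : Fin n => isQuartic (z (some i)) = true)
  simp only [card_univ, Fintype.card_fin] at h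
  omega

/-- The sum over the connected graphs of the colourings with exactly `q` quartic vertices — a number independent of
`(λ, δm²)` (it depends on `m²`, the lattice and the observable only). [cite: Balaban1983Higgs3, (1.21) p.416] -/
def graphSum (C : ChargeData N) (msq : ℝ) (a b : Fin N) (x x' : HiggsLattice.Site P k) (n q : ℕ) : ℝ :=
  ∑ z ∈ (Fintype.piFinset (cK (P := P) (k := k) (N := N) (n := n))).filter (fun z => qCount z = q),
    ∑ g ∈ (diags (Sigma.fst : Leg cdeg z → Option (Fin n))
        ((univ : Finset (Option (Fin n))).map Function.Embedding.some)).filter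
        (IsConn (Sigma.fst : Leg cdeg z → Option (Fin n)) ((univ : Finset (Option (Fin n))).map Function.Embedding.some)),
      ∏ B ∈ g.2, pairW (precMat (P := P) (k := k) C msq) (legVec cdeg (clv a b x x') z) B

/-- **REGROUPING BY THE NUMBER OF QUARTIC VERTICES**: the colouring sum of the headline is a homogeneous polynomial of
degree `n` in `(λ, δm²)`: `Σ_z (Π ccoef)·G(z) = Σ_{q ≤ n} λ^q (δm²)^{n−q} · (−ε^d)^q(−½ε^d)^{n−q} · graphSum n q`.
[cite: Balaban1983Higgs3, (1.21) p.416] -/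
theorem sum_colourings_eq_polynomial (C : ChargeData N) (msq lam dm2 : ℝ) (a b : Fin N)
    (x x' : HiggsLattice.Site P k) (n : ℕ) :
    ∑ z ∈ Fintype.piFinset (cK (P := P) (k := k) (N := N) (n := n)),
        (∏ j, ccoef (P := P) (k := k) (N := N) (P.mesh k ^ P.d) lam dm2 j (z j)) *
          ∑ g ∈ (diags (Sigma.fst : Leg cdeg z → Option (Fin n))
              ((univ : Finset (Option (Fin n))).map Function.Embedding.some)).filter
              (IsConn (Sigma.fst : Leg cdeg z → Option (Fin n))
                ((univ : Finset (Option (Fin n))).map Function.Embedding.some)),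
            ∏ B ∈ g.2, pairW (precMat (P := P) (k := k) C msq) (legVec cdeg (clv a b x x') z) B
      = ∑ q ∈ range (n + 1), lam ^ q * dm2 ^ (n - q)
          * ((-(P.mesh k ^ P.d)) ^ q * (-(P.mesh k ^ P.d / 2)) ^ (n - q) * graphSum C msq a b x x' n q) := by
  have hmaps : ∀ z ∈ Fintype.piFinset (cK (P := P) (k := k) (N := N) (n := n)), qCount z ∈ range (n + 1) :=
    fun z _ => mem_range.2 (Nat.lt_succ_of_le (qCount_le z))
  refine (sum_fiberwise_of_maps_to hmaps _).symm.trans (sum_congr rfl fun q _ => ?_)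
  rw [graphSum, Finset.mul_sum, Finset.mul_sum]
  refine sum_congr rfl fun z hz => ?_
  obtain ⟨hz, hq⟩ := mem_filter.1 hz
  rw [prod_ccoef_eq _ _ _ hz, hq]
  have e1 : (-(P.mesh k ^ P.d * lam)) ^ q = lam ^ q * (-(P.mesh k ^ P.d)) ^ q := by
    rw [← mul_pow]; ring
  have e2 : (-(P.mesh k ^ P.d * (dm2 / 2))) ^ (n - q) = dm2 ^ (n - q) * (-(P.mesh k ^ P.d / 2)) ^ (n - q) := by
    rw [← mul_pow]; ring
  rw [e1, e2]
  ring

end Polynomial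

section HeadlinePolynomial

open B1Sect1Statements

variable {D : ModelData} {P : HiggsLattice.Params}

/-- **THE VERTEX COEFFICIENTS OF (1.19) ARE POLYNOMIALS IN `(λ, δm²)` WITH GRAPH-SUM COEFFICIENTS** (`e = 0`):
`(d/dt)ⁿ G^ε_t|_{0⁺} = Σ_{q=0}^{n} λ^q (δm²)^{n−q} · (−ε^d)^q (−½ε^d)^{n−q} · graphSum n q` — the structure of print's
perturbative series in the coupling constants at `e = 0` (with `δm²` itself a series in `λ`, (1.23)), each coefficient a
sum over connected Feynman graphs with `q` vertices (1.6) and `n − q` vertices (1.7).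
[cite: Balaban1983Higgs3, (1.21)–(1.23) pp.416–417] -/
theorem iteratedDerivWithin_twoPointFamily_eq_polynomial (he : D.C.e = 0) (hm : 0 < D.msq) (hmu : 0 < D.mu0sq)
    (hlam : 0 < D.lam) (a b : Fin D.N) (x x' : HiggsLattice.Site P 0) (n : ℕ) :
    iteratedDerivWithin n (twoPointFamily D P a b x x') (Set.Ici 0) 0
      = ∑ q ∈ Finset.range (n + 1), D.lam ^ q * (D.δmsq P.ε D.C.e D.lam) ^ (n - q)
          * ((-(P.mesh 0 ^ P.d)) ^ q * (-(P.mesh 0 ^ P.d / 2)) ^ (n - q)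
            * graphSum (P := P) (k := 0) D.C D.msq a b x x' n q) := by
  rw [iteratedDerivWithin_twoPointFamily_eq_sum_connected he hm hmu hlam, sum_colourings_eq_polynomial]

end HeadlinePolynomial

/-! ## §9 (v1.2) Translation invariance: `C₀(x + εe_μ, a; x′ + εe_μ, b) = C₀(x, a; x′, b)` — print's `C^ε_0(x − x′)` -/

section Translation

variable {P : HiggsLattice.Params} {k N : ℕ}

/-- Unit translations of the torus commute. [folklore] [cite: Balaban1982Higgs1, (1.2) p.604] -/
private theorem shift_shift_comm (x : HiggsLattice.Site P k) (μ ν : Fin P.d) :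
    (x.shift μ).shift ν = (x.shift ν).shift μ := by
  funext κ
  unfold HiggsLattice.Site.shift
  rcases eq_or_ne κ ν with rfl | h1
  · rcases eq_or_ne κ μ with rfl | h2
    · simp only [Function.update_self]
    · simp only [Function.update_self, Function.update_of_ne h2]
  · rcases eq_or_ne κ μ with rfl | h2
    · simp only [Function.update_self, Function.update_of_ne h1]
    · simp only [Function.update_of_ne h1, Function.update_of_ne h2]

/-- `(x − e_ν) + e_μ = (x + e_μ) − e_ν`. [folklore] [cite: Balaban1982Higgs1, (1.2) p.604] -/
private theorem unshift_shift_comm (x : HiggsLattice.Site P k) (μ ν : Fin P.d) :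
    (x.unshift ν).shift μ = (x.shift μ).unshift ν := by
  have h : ((x.unshift ν).shift μ).shift ν = ((x.shift μ).unshift ν).shift ν := by
    rw [shift_shift_comm, HiggsCovariancePos.shift_unshift, HiggsCovariancePos.shift_unshift]
  simpa only [HiggsCovariancePos.unshift_shift] using congrArg (fun y => y.unshift ν) h

/-- Translation of a scalar field by one lattice step in direction `μ`. [cite: Balaban1983Higgs3, (1.22) p.416] -/
def translate (μ : Fin P.d) (φ : ScalarField P k N) : ScalarField P k N := fun y => φ (y.shift μ)

/-- [cite: Balaban1983Higgs3, (1.22) p.416] -/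
theorem translate_apply (μ : Fin P.d) (φ : ScalarField P k N) (y : HiggsLattice.Site P k) :
    translate μ φ y = φ (y.shift μ) := rfl

/-- `−Δ^ε_0 + m²` commutes with the unit translations of the torus. [cite: Balaban1983Higgs3, (1.22) p.416] -/
theorem freeOp_translate (C : ChargeData N) (msq : ℝ) (μ : Fin P.d) (φ : ScalarField P k N) :
    freeOp C msq (translate μ φ) = translate μ (freeOp C msq φ) := by
  funext y
  ext c
  rw [translate_apply, freeOp_apply_apply, freeOp_apply_apply]
  simp only [translate_apply, shift_shift_comm y _ μ, unshift_shift_comm]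

/-- The translated source: `δ_{x′} ⊗ e_b` translated by `e_μ` is `δ_{x′ − e_μ} ⊗ e_b`. [cite: Balaban1983Higgs3, (1.22) p.416] -/
theorem translate_single (μ : Fin P.d) (x' : HiggsLattice.Site P k) (v : E N) (c : ℝ) :
    translate μ (c • (Pi.single x' v : ScalarField P k N)) = c • (Pi.single (x'.unshift μ) v : ScalarField P k N) := by
  funext y
  rw [translate_apply, Pi.smul_apply, Pi.smul_apply]
  congr 1
  by_cases hy : y = x'.unshift μ
  · subst hy
    rw [HiggsCovariancePos.shift_unshift, Pi.single_eq_same, Pi.single_eq_same]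
  · have hne : y.shift μ ≠ x' := fun h => hy (by rw [← h, HiggsCovariancePos.unshift_shift])
    rw [Pi.single_eq_of_ne hne, Pi.single_eq_of_ne hy]

/-- The translated propagator column is the column at the translated point. [cite: Balaban1983Higgs3, (1.22) p.416] -/
theorem translate_propCol (C : ChargeData N) {msq : ℝ} (hm : 0 < msq) (μ : Fin P.d) (x' : HiggsLattice.Site P k)
    (b : Fin N) : translate μ (propCol (P := P) (k := k) C msq x' b) = propCol C msq (x'.unshift μ) b := by
  apply freeOp_injective C hm
  rw [freeOp_translate, freeOp_propCol C hm, freeOp_propCol C hm, translate_single]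

/-- **TRANSLATION INVARIANCE `C^ε_0(x − x′)`**: `C₀(x + εe_μ, a; x′ + εe_μ, b) = C₀(x, a; x′, b)` (`e = 0`) — the free
propagator depends on `x − x′` only, by uniqueness of the Green's function and translation covariance of `−Δ^ε_0`.
[cite: Balaban1983Higgs3, (1.22) p.416] -/
theorem prop0_shift (C : ChargeData N) (he : C.e = 0) {msq mu0sq : ℝ} (hm : 0 < msq) (hmu : 0 < mu0sq)
    (x : HiggsLattice.Site P k) (a : Fin N) (x' : HiggsLattice.Site P k) (b : Fin N) (μ : Fin P.d) :
    prop0 P k N C msq mu0sq (x.shift μ) a (x'.shift μ) b = prop0 P k N C msq mu0sq x a x' b := by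
  rw [← propCol_apply C he hm hmu (x'.shift μ) b (x.shift μ) a, ← translate_apply μ (propCol C msq (x'.shift μ) b) x,
    translate_propCol C hm, HiggsCovariancePos.unshift_shift, propCol_apply C he hm hmu]

end Translation

end Literature.MathematicalPhysics.QuantumFieldTheory.Balaban1983to89.B3Eq119ConnectedGraphs
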